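import Summits.KontsevichZagierPeriods.KontsevichZagierPeriods.Theorems.RootDecompRelativeModAbsoluteCylLogSplitP17

/-! # `RootDecompRelativeModAbsoluteCylLogSplitP18` — part 18/25 of the mechanical ≤330-line split of `CylLogSplit.lean`
(split by the decomp-kz census seat for landing; mathematics unchanged; part 18 continues part 17). -/

noncomputable section
open Set MeasureTheory Filter Topology
open scoped BigOperators
open Literature.NumberTheory.Transcendental Literature.ModelTheory.ExponentialFields

namespace Summit.KontsevichZagierPeriods.RootDecompRelativeModAbsolute.Rung30571

namespace RegularisedLogLayer

namespace CylLog
variable {b : ℕ}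

namespace MixedInstance
open DegenerateInstance

/-- Auxiliary step `κN_neg`. [bookkeeping] -/
theorem κN_neg : ∀ x ∈ G, κN x < 0 := fun x hx => by
  have h0 := hx.1
  simp only [κN]
  exact div_neg_of_neg_of_pos (by linarith) (by linarith)

/-- Auxiliary step `κN_gt`. [bookkeeping] -/
theorem κN_gt : ∀ x ∈ G, -1 < κN x := fun x hx => by
  have h0 := hx.1
  have h1 : (0:ℝ) < 1 + x 0 := by linarith
  simp only [κN]
  rw [lt_div_iff₀ h1]
  linarith

/-- Auxiliary step `one_add_κN`. [bookkeeping] -/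
theorem one_add_κN : ∀ x ∈ G, 1 + κN x = 1 / (1 + x 0) := fun x hx => by
  have h := one_add_ne x hx
  simp only [κN]
  field_simp
  ring

/-- Auxiliary step `κP_diff`. [bookkeeping] -/
theorem κP_diff : DifferentiableOn ℝ κP G :=
  (show Differentiable ℝ κP from by unfold κP; fun_prop).differentiableOn

/-- Auxiliary step `κN_diff`. [bookkeeping] -/
theorem κN_diff : DifferentiableOn ℝ κN G := by
  have h1 : DifferentiableOn ℝ (fun x : Fin 1 → ℝ => -x 0) G :=
    (show Differentiable ℝ (fun x : Fin 1 → ℝ => -x 0) from by fun_prop).differentiableOn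
  have h2 : DifferentiableOn ℝ (fun x : Fin 1 → ℝ => 1 + x 0) G :=
    (show Differentiable ℝ (fun x : Fin 1 → ℝ => 1 + x 0) from by fun_prop).differentiableOn
  have h3 := h1.mul (h2.inv one_add_ne)
  exact h3.congr fun x _ => div_eq_mul_inv _ _

/-- Auxiliary step `polyLog_one_eq`. [bookkeeping] -/
theorem polyLog_one_eq (w : ℝ) : polyLog 1 w = w - 1 := by
  simp [polyLog]

/-- Size of a cylinder monomial at a NEGATIVE end: `|c θ/(1+θκ)| ≤ |c|/(1+κ)` for `0 ≤ θ ≤ 1`, `−1 < κ ≤ 0`. -/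
theorem abs_term_le_neg {c κ : (Fin 1 → ℝ) → ℝ} {z : Fin (1 + 1) → ℝ} (h0 : 0 ≤ z (Fin.last 1))
    (h1 : z (Fin.last 1) ≤ 1) (hk0 : κ (Fin.init z) ≤ 0) (hk1 : -1 < κ (Fin.init z)) :
    |term c κ z| ≤ |c (Fin.init z)| / (1 + κ (Fin.init z)) := by
  have hk : 0 < 1 + κ (Fin.init z) := by linarith
  have hle : 1 + κ (Fin.init z) ≤ 1 + z (Fin.last 1) * κ (Fin.init z) := by
    nlinarith [mul_nonneg (neg_nonneg.mpr hk0) (sub_nonneg.mpr h1)]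
  have hden : 0 < 1 + z (Fin.last 1) * κ (Fin.init z) := lt_of_lt_of_le hk hle
  have ha : 0 ≤ z (Fin.last 1) ^ 1 / (1 + z (Fin.last 1) * κ (Fin.init z)) := by
    rw [pow_one]; exact div_nonneg h0 hden.le
  have hb : z (Fin.last 1) ^ 1 / (1 + z (Fin.last 1) * κ (Fin.init z)) ≤ 1 / (1 + κ (Fin.init z)) := by
    rw [pow_one]
    calc z (Fin.last 1) / (1 + z (Fin.last 1) * κ (Fin.init z))
        ≤ 1 / (1 + z (Fin.last 1) * κ (Fin.init z)) := div_le_div_of_nonneg_right h1 hden.le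
      _ ≤ 1 / (1 + κ (Fin.init z)) := div_le_div_of_nonneg_left zero_le_one hk hle
  rw [term, abs_mul, abs_of_nonneg ha]
  calc |c (Fin.init z)| * (z (Fin.last 1) ^ 1 / (1 + z (Fin.last 1) * κ (Fin.init z)))
      ≤ |c (Fin.init z)| * (1 / (1 + κ (Fin.init z))) := mul_le_mul_of_nonneg_left hb (abs_nonneg _)
    _ = |c (Fin.init z)| / (1 + κ (Fin.init z)) := by ring

/-- **The mixed-orientation two-term family is a Kontsevich–Zagier relation** (critic's glue test (i)). -/
theorem mixedFamily_mem_relations (V : KZ.IntegralRep (1 + 1)) (hVd : V.domain = cyl)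
    (hVi : ∀ z ∈ cyl, V.integrand z = a₀ (Fin.init z) + term cP κP z + term cN κN z) :
    KZ.of V ∈ KZ.relations := by
  have hG := isSemialgebraic_G
  have hGo := isOpen_G
  have hGm : MeasurableSet G := hG.measurableSet_holds
  have hcyl := isSemialgebraic_cyl
  have h0sa : IsSemialgebraicFunOn ℚ G (fun _ => (0:ℝ)) :=
    (isSemialgebraicFunOn_ratCast hG 0).congr fun _ _ => by simp
  have h1sa : IsSemialgebraicFunOn ℚ G (fun _ => (1:ℝ)) :=
    (isSemialgebraicFunOn_ratCast hG 1).congr fun _ _ => by simp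
  have hband : IsSemialgebraic ℚ (KZlog.band G (fun _ => (0:ℝ)) (fun _ => 1)) :=
    KZlog.isSemialgebraic_band h0sa h1sa
  have hcylG : cyl ⊆ {z | (Fin.init z : Fin 1 → ℝ) ∈ G} := fun z hz => hz.1
  have hbandG : KZlog.band G (fun _ => (0:ℝ)) (fun _ => 1) ⊆ {z | (Fin.init z : Fin 1 → ℝ) ∈ G} :=
    fun z hz => hz.1
  have hx0 : ∀ x ∈ G, x 0 ≠ 0 := fun x hx => hx.1.ne'
  -- no poles
  have hdenP : ∀ z ∈ KZlog.band G (fun _ => (0:ℝ)) (fun _ => 1),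
      1 + z (Fin.last 1) * κP (Fin.init z) ≠ 0 := fun z hz => by
    have hx : 0 < Fin.init z 0 := hz.1.1
    have hθ : 0 ≤ z (Fin.last 1) := hz.2.1
    simp only [κP]
    positivity
  have hdenN : ∀ z ∈ KZlog.band G (fun _ => (0:ℝ)) (fun _ => 1),
      1 + z (Fin.last 1) * κN (Fin.init z) ≠ 0 := fun z hz => by
    have hk0 := (κN_neg _ hz.1).le
    have hk1 := κN_gt _ hz.1
    have hθ1 : z (Fin.last 1) ≤ 1 := hz.2.2
    have : 0 < 1 + z (Fin.last 1) * κN (Fin.init z) := by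
      nlinarith [mul_nonneg (neg_nonneg.mpr hk0) (sub_nonneg.mpr hθ1)]
    exact this.ne'
  have hdenPc : ∀ z ∈ cyl, 1 + z (Fin.last 1) * κP (Fin.init z) ≠ 0 :=
    fun z hz => hdenP z (cyl_subset_band hz)
  have hdenNc : ∀ z ∈ cyl, 1 + z (Fin.last 1) * κN (Fin.init z) ≠ 0 :=
    fun z hz => hdenN z (cyl_subset_band hz)
  -- semialgebraicity of the pieces
  have hsaPc : IsSemialgebraicFunOn ℚ cyl (term cP κP) := sa_term hcyl hcylG sa_cP sa_κP hdenPc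
  have hsaNc : IsSemialgebraicFunOn ℚ cyl (term cN κN) := sa_term hcyl hcylG sa_cN sa_κN hdenNc
  have hsaPb : IsSemialgebraicFunOn ℚ (KZlog.band G (fun _ => (0:ℝ)) (fun _ => 1)) (term cP κP) :=
    sa_term hband hbandG sa_cP sa_κP hdenP
  have hsaNb : IsSemialgebraicFunOn ℚ (KZlog.band G (fun _ => (0:ℝ)) (fun _ => 1)) (term cN κN) :=
    sa_term hband hbandG sa_cN sa_κN hdenN
  have ha₀c : IsSemialgebraicFunOn ℚ cyl (fun z => a₀ (Fin.init z)) := sa_a₀.comp_init.mono hcylG hcyl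
  have ha₀b : IsSemialgebraicFunOn ℚ (KZlog.band G (fun _ => (0:ℝ)) (fun _ => 1))
      (fun z => a₀ (Fin.init z)) := sa_a₀.comp_init.mono hbandG hband
  have hV₁sa : IsSemialgebraicFunOn ℚ cyl (fun z => a₀ (Fin.init z) + term cP κP z) :=
    IsSemialgebraicFunOn.add_holds ha₀c hsaPc
  -- bounds
  have ha₀G : ∀ x ∈ G, |a₀ x| ≤ 1 := fun x hx => by
    have h0 := hx.1
    have h1 := hx.2
    have hp : (0:ℝ) < 1 + x 0 := by linarith
    simp only [a₀, neg_div, abs_neg]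
    rw [abs_of_nonneg (div_nonneg (sq_nonneg _) hp.le), div_le_one hp]
    nlinarith
  have hcPG : ∀ x ∈ G, |cP x| ≤ 1 := fun x hx => by
    simp only [cP]
    rw [abs_of_nonneg (sq_nonneg _)]
    nlinarith [hx.1, hx.2]
  have hcNG : ∀ x ∈ G, |cN x| / (1 + κN x) ≤ 1 := fun x hx => by
    have h0 := hx.1
    have h1 := hx.2
    have hp : (0:ℝ) < 1 + x 0 := by linarith
    rw [one_add_κN x hx]
    simp only [cN]
    rw [abs_of_nonneg (div_nonneg (sq_nonneg _) (sq_nonneg _))]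
    have e : x 0 ^ 2 / (1 + x 0) ^ 2 / (1 / (1 + x 0)) = x 0 ^ 2 / (1 + x 0) := by
      field_simp
    rw [e, div_le_one hp]
    nlinarith
  have hbP : ∀ z ∈ KZlog.band G (fun _ => (0:ℝ)) (fun _ => 1), |term cP κP z| ≤ 1 := fun z hz =>
    (abs_term_le hz.2.1 hz.2.2 (κP_pos _ hz.1).le).trans (hcPG _ hz.1)
  have hbN : ∀ z ∈ KZlog.band G (fun _ => (0:ℝ)) (fun _ => 1), |term cN κN z| ≤ 1 := fun z hz =>
    (abs_term_le_neg hz.2.1 hz.2.2 (κN_neg _ hz.1).le (κN_gt _ hz.1)).trans (hcNG _ hz.1)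
  have hba₀ : ∀ z ∈ KZlog.band G (fun _ => (0:ℝ)) (fun _ => 1), |a₀ (Fin.init z)| ≤ 1 :=
    fun z hz => ha₀G _ hz.1
  have hbPc : ∀ z ∈ cyl, |term cP κP z| ≤ 1 := fun z hz => hbP z (cyl_subset_band hz)
  have hbNc : ∀ z ∈ cyl, |term cN κN z| ≤ 1 := fun z hz => hbN z (cyl_subset_band hz)
  have hba₀c : ∀ z ∈ cyl, |a₀ (Fin.init z)| ≤ 1 := fun z hz => hba₀ z (cyl_subset_band hz)
  have hbV₁ : ∀ z ∈ cyl, |a₀ (Fin.init z) + term cP κP z| ≤ 2 := fun z hz =>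
    (abs_add_le _ _).trans (by linarith [hbPc z hz, hba₀c z hz])
  -- the representations on the open square
  let A₀ : KZ.IntegralRep (1 + 1) :=
    { domain := cyl, integrand := fun z => a₀ (Fin.init z), isSemialgebraic_domain := hcyl,
      isSemialgebraicFunOn_integrand := ha₀c,
      integrableOn := integrableOn_of_abs_le hcyl volume_cyl_lt_top ha₀c 1 hba₀c }
  let CyP : KZ.IntegralRep (1 + 1) :=
    { domain := cyl, integrand := term cP κP, isSemialgebraic_domain := hcyl,
      isSemialgebraicFunOn_integrand := hsaPc,
      integrableOn := integrableOn_of_abs_le hcyl volume_cyl_lt_top hsaPc 1 hbPc }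
  let CyN : KZ.IntegralRep (1 + 1) :=
    { domain := cyl, integrand := term cN κN, isSemialgebraic_domain := hcyl,
      isSemialgebraicFunOn_integrand := hsaNc,
      integrableOn := integrableOn_of_abs_le hcyl volume_cyl_lt_top hsaNc 1 hbNc }
  let V₁ : KZ.IntegralRep (1 + 1) :=
    { domain := cyl, integrand := fun z => a₀ (Fin.init z) + term cP κP z, isSemialgebraic_domain := hcyl,
      isSemialgebraicFunOn_integrand := hV₁sa,
      integrableOn := integrableOn_of_abs_le hcyl volume_cyl_lt_top hV₁sa 2 hbV₁ }
  -- (1) split the integrand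
  have r1 : KZ.of V - KZ.of V₁ - KZ.of CyN ∈ KZ.relations :=
    KZ.integrandAddRel_subset_relations ⟨1 + 1, V, V₁, CyN, by rw [hVd], by rw [hVd],
      fun z hz => by rw [hVi z (hVd ▸ hz)]; rfl, rfl⟩
  have r2 : KZ.of V₁ - KZ.of A₀ - KZ.of CyP ∈ KZ.relations :=
    KZ.integrandAddRel_subset_relations ⟨1 + 1, V₁, A₀, CyP, rfl, rfl, fun z _ => rfl, rfl⟩
  -- (2) open square → closed band
  obtain ⟨A₀', hA₀'d, hA₀'i, r3⟩ := exists_closedBand_of_openCell' (a := fun _ => (0:ℝ))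
    (c := fun _ => (1:ℝ)) h0sa h1sa A₀ rfl (fun z => a₀ (Fin.init z)) ha₀b (fun _ _ => rfl)
  obtain ⟨CyP', hCyP'd, hCyP'i, r4⟩ := exists_closedBand_of_openCell' (a := fun _ => (0:ℝ))
    (c := fun _ => (1:ℝ)) h0sa h1sa CyP rfl (term cP κP) hsaPb (fun _ _ => rfl)
  obtain ⟨CyN', hCyN'd, hCyN'i, r5⟩ := exists_closedBand_of_openCell' (a := fun _ => (0:ℝ))
    (c := fun _ => (1:ℝ)) h0sa h1sa CyN rfl (term cN κN) hsaNb (fun _ _ => rfl)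
  -- (3) cylinder terms → regularised cells (D4), one of EACH orientation
  obtain ⟨Rg₁, hRg₁d, hRg₁i, r6⟩ := exists_regRep_sub_mem_relations (M := 1) hGo hG sa_cP sa_κP
    κP_diff κP_pos CyP' hCyP'd (fun z _ => by rw [hCyP'i]; rfl)
  obtain ⟨Rg₂, hRg₂d, hRg₂i, r7⟩ := exists_regNegRep_sub_mem_relations (M := 1) hGo hG sa_cN sa_κN
    κN_diff κN_neg κN_gt CyN' hCyN'd (fun z _ => by rw [hCyN'i]; rfl)
  -- the reversed cell with the POSITIVE kernel: R₂' = −Rg₂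
  let R₂' : KZ.IntegralRep (1 + 1) :=
    { domain := Rg₂.domain, integrand := fun z => -Rg₂.integrand z,
      isSemialgebraic_domain := Rg₂.isSemialgebraic_domain,
      isSemialgebraicFunOn_integrand := Rg₂.isSemialgebraicFunOn_integrand.neg,
      integrableOn := Rg₂.integrableOn.neg }
  have r8 : KZ.of Rg₂ + KZ.of R₂' ∈ KZ.relations :=
    KZ.of_add_of_mem_relations_of_eqOn_neg (r := Rg₂) (r' := R₂') rfl fun z _ => rfl
  -- (4) the general D7 theorem with U = (W_P), U' = (W_N), V = V' = ∅, d = 1, m = 1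
  have hWPsa : IsSemialgebraicFunOn ℚ G (fun x => 1 + κP x) := IsSemialgebraicFunOn.add_holds h1sa sa_κP
  have hWNsa : IsSemialgebraicFunOn ℚ G (fun x => 1 + κN x) := IsSemialgebraicFunOn.add_holds h1sa sa_κN
  have hWPd : DifferentiableOn ℝ (fun x => 1 + κP x) G := (differentiableOn_const _).add κP_diff
  have hWNd : DifferentiableOn ℝ (fun x => 1 + κN x) G := (differentiableOn_const _).add κN_diff
  have hWP1 : ∀ x ∈ G, 1 ≤ 1 + κP x := fun x hx => by linarith [κP_pos x hx]
  have hWN0 : ∀ x ∈ G, 0 < 1 + κN x := fun x hx => by linarith [κN_gt x hx]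
  have hWN1 : ∀ x ∈ G, 1 + κN x ≤ 1 := fun x hx => by linarith [κN_neg x hx]
  have hprod1 : ∀ x ∈ G, (1 + κP x) * (1 + κN x) = 1 := fun x hx => by
    rw [one_add_κN x hx]
    have h := one_add_ne x hx
    simp only [κP]
    field_simp
  have hrel : ∀ x ∈ G, (∏ _i : Fin 1, (1 + κP x)) * ∏ _i : Fin 1, (1 + κN x) =
      (∏ j : Fin 0, (Fin.elim0 j : (Fin 1 → ℝ) → ℝ) x) * ∏ j : Fin 0, (Fin.elim0 j : (Fin 1 → ℝ) → ℝ) x :=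
    fun x hx => by
      simp only [Fin.prod_univ_one, Finset.univ_eq_empty, Finset.prod_empty, mul_one]
      exact hprod1 x hx
  have hL1 : ∀ x ∈ G, 1 ≤ (∏ _i : Fin 1, (1 + κP x)) * ∏ _i : Fin 1, (1 + κN x) := fun x hx => by
    simp only [Fin.prod_univ_one]
    rw [hprod1 x hx]
  have hsq : IntegrableOn (fun x : Fin 1 → ℝ => x 0 ^ 2) G :=
    integrableOn_of_abs_le hG volume_G_lt_top (isSemialgebraicFunOn_pow' hG sa_x 2) 1 fun x hx => by
      rw [abs_of_nonneg (sq_nonneg _)]; nlinarith [hx.1, hx.2]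
  have hsq' : IntegrableOn (fun x : Fin 1 → ℝ => x 0 ^ 2 / (1 + x 0)) G := by
    refine integrableOn_of_abs_le hG volume_G_lt_top
      (IsSemialgebraicFunOn.div (isSemialgebraicFunOn_pow' hG sa_x 2) sa_one_add one_add_ne) 1
      fun x hx => ?_
    have h := ha₀G x hx
    simp only [a₀, neg_div, abs_neg] at h
    exact h
  have hRg₁i' : EqOn Rg₁.integrand (fun z => (fun _ : Fin 1 → ℝ => (1:ℝ)) (Fin.init z) *
      ((z (Fin.last 1) - 1) ^ 1 / z (Fin.last 1))) Rg₁.domain := by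
    intro z hz
    have hz' : z ∈ KZlog.band G (fun _ => (1:ℝ)) (fun x => 1 + κP x) := hRg₁d ▸ hz
    have hx : Fin.init z 0 ≠ 0 := hx0 _ hz'.1
    rw [hRg₁i]
    simp only [cP, κP, one_add_one_eq_two]
    field_simp
  have hR₂'i : EqOn R₂'.integrand (fun z => (fun _ : Fin 1 → ℝ => (1:ℝ)) (Fin.init z) *
      ((z (Fin.last 1) - 1) ^ 1 / z (Fin.last 1))) R₂'.domain := by
    intro z hz
    have hz' : z ∈ KZlog.band G (fun x => 1 + κN x) (fun _ => (1:ℝ)) := hRg₂d ▸ hz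
    have hx : Fin.init z 0 ≠ 0 := hx0 _ hz'.1
    have hx1 : (1:ℝ) + Fin.init z 0 ≠ 0 := one_add_ne _ hz'.1
    have ht : z (Fin.last 1) ≠ 0 := (lt_of_lt_of_le (hWN0 _ hz'.1) hz'.2.1).ne'
    show -Rg₂.integrand z = _
    rw [hRg₂i]
    simp only [cN, κN, neg_div, one_add_one_eq_two, neg_sq, neg_mul, neg_neg]
    field_simp
  obtain ⟨B, hBd, hBi, hT⟩ := regCells_mem_relations_of_relation (m := 1) (k₁ := 1) (k₂ := 1)
    (l₁ := 0) (l₂ := 0) (d := fun _ => (1:ℝ)) hGo hG h1sa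
    (fun _ => fun x => 1 + κP x) (fun _ => fun x => 1 + κN x)
    (fun j => Fin.elim0 j) (fun j => Fin.elim0 j)
    (fun _ => hWPsa) (fun _ => hWNsa) (fun j => Fin.elim0 j) (fun j => Fin.elim0 j)
    (fun _ => hWPd) (fun _ => hWNd) (fun j => Fin.elim0 j) (fun j => Fin.elim0 j)
    (fun _ => hWP1) (fun _ => hWN0) (fun _ => hWN1)
    (fun j => Fin.elim0 j) (fun j => Fin.elim0 j) (fun j => Fin.elim0 j)
    hrel (Or.inl hL1)
    (hsq.congr_fun (fun x hx => by simp only [Fin.prod_univ_one, κP]; ring) hGm)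
    (hsq'.congr_fun (fun x hx => by
      have h := one_add_ne x hx
      simp only [Fin.prod_univ_one, one_add_κN x hx, one_add_one_eq_two]
      field_simp
      ring) hGm)
    (integrableOn_zero.congr_fun (fun x _ => by simp) hGm)
    (integrableOn_zero.congr_fun (fun x _ => by simp) hGm)
    (fun _ => Rg₁) (fun _ => R₂') (fun j => Fin.elim0 j) (fun j => Fin.elim0 j)
    (fun _ => hRg₁d) (fun _ => hRg₁i') (fun _ => hRg₂d) (fun _ => hR₂'i)
    (fun j => Fin.elim0 j) (fun j => Fin.elim0 j) (fun j => Fin.elim0 j) (fun j => Fin.elim0 j)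
  have hT' : KZ.of Rg₁ - KZ.of R₂' - KZ.of B ∈ KZ.relations := by
    simpa using hT
  -- (5) the base term `[G, a₀]` by Newton–Leibniz (F = θ·a₀(x)) and the cancellation `a₀ + B ≡ 0`
  let Ba : KZ.IntegralRep 1 :=
    { domain := G, integrand := a₀, isSemialgebraic_domain := hG,
      isSemialgebraicFunOn_integrand := sa_a₀,
      integrableOn := integrableOn_of_abs_le hG volume_G_lt_top sa_a₀ 1 ha₀G }
  have hFsa : IsSemialgebraicFunOn ℚ A₀'.domain (fun z => z (Fin.last 1) * a₀ (Fin.init z)) := by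
    rw [hA₀'d]
    exact IsSemialgebraicFunOn.mul_holds (isSemialgebraicFunOn_apply hband (Fin.last 1)) ha₀b
  have r11 : KZ.of A₀' - KZ.of Ba ∈ KZ.relations := by
    refine KZ.newtonLeibnizRel_subset_relations ⟨1, A₀', Ba, fun _ => 0, fun _ => 1,
      fun z => z (Fin.last 1) * a₀ (Fin.init z), hFsa, h0sa, h1sa, fun _ _ => zero_le_one,
      ?_, ?_, ?_, ?_, rfl⟩
    · rw [hA₀'d]; rfl
    · intro x _
      simp only [Fin.snoc_last, Fin.init_snoc]
      fun_prop
    · intro x _ t _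
      simp only [Fin.snoc_last, Fin.init_snoc, hA₀'i]
      simpa using (hasDerivAt_id' t).mul_const (a₀ x)
    · intro x _
      show a₀ x = _
      simp only [Fin.snoc_last, Fin.init_snoc]
      ring
  have r12 : KZ.of Ba + KZ.of B ∈ KZ.relations := by
    refine KZ.of_add_of_mem_relations_of_eqOn_neg (r := Ba) (r' := B) hBd fun x hx => ?_
    have hx' : x ∈ G := hx
    have h := one_add_ne x hx'
    show B.integrand x = -(a₀ x)
    rw [hBi]
    simp only [Fin.sum_univ_one, Finset.univ_eq_empty, Finset.sum_empty, add_zero, sub_zero,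
      polyLog_one_eq, a₀, κP, κN]
    field_simp
    ring
  -- (6) assemble
  have e : KZ.of V = (KZ.of V - KZ.of V₁ - KZ.of CyN) + (KZ.of V₁ - KZ.of A₀ - KZ.of CyP) +
      (KZ.of A₀ - KZ.of A₀') + (KZ.of CyP - KZ.of CyP') + (KZ.of CyN - KZ.of CyN') +
      (KZ.of CyP' - KZ.of Rg₁) + (KZ.of CyN' - KZ.of Rg₂) + (KZ.of Rg₂ + KZ.of R₂') +
      (KZ.of Rg₁ - KZ.of R₂' - KZ.of B) + (KZ.of A₀' - KZ.of Ba) + (KZ.of Ba + KZ.of B) := by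
    abel
  rw [e]
  exact add_mem (add_mem (add_mem (add_mem (add_mem (add_mem (add_mem (add_mem (add_mem (add_mem
    r1 r2) r3) r4) r5) r6) r7) r8) hT') r11) r12

end MixedInstance
end CylLog
end RegularisedLogLayer
end Summit.KontsevichZagierPeriods.RootDecompRelativeModAbsolute.Rung30571
end
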